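import Literature.Geometry.Lorentzian.InitialDataInterpolation
import Literature.Geometry.Lorentzian.InitialDataLocality
import Literature.Geometry.Lorentzian.InteriorKerrGluing
import Literature.Geometry.Lorentzian.ChartCalculus
import HarnessLib

/-!
# Extending an initial data set from a ball to all of `ℝ³` by a radial cut-off

Topic `Literature/Geometry/Lorentzian`. Everything in this file is PROVED (one definition with a
body, theorems); there are no named facts.

Gluing constructions produce initial data `(h, k)` on a bounded region of `ℝ³` — e.g. the data
induced by a collapsing vacuum spacetime on a spacelike `3`-ball (Li–Mei, *A construction of
collapsing spacetimes in vacuum*, arXiv:2005.01249, §2.2: the data induced on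
`Σ⁺_IV ∪ Σ⁺_III ∪ H`) — while the tree's transported statements (`LiMei.shortPulseCylinderData`,
`LiMei.interiorKerrGluing`) speak of smooth data on ALL of `E3` that are constrained only on a ball
or an annulus ("unconstrained beyond `ρ₂`: any smooth extension, e.g. by a cutoff towards the flat
data"). This file provides that extension once and for all: for a datum `D₀` on an open set
`U ⊆ E3` containing the closed ball `{‖y‖ ≤ σ₂}` and radii `0 ≤ σ₁ < σ₂`, the datum

`extendByCutoff D₀ = (φ h₀ + (1 − φ) δ, φ k₀)`, `φ = radialCutoff σ₁ σ₂`,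

is a smooth initial data set on `E3` (a convex combination of Riemannian metrics is Riemannian),
which EQUALS `D₀` on `{‖y‖ ≤ σ₁}` (`extendByCutoff_h_inner_of_norm_le`, `extendByCutoff_k_of_norm_le`)
and therefore satisfies the vacuum constraints on the open ball `{‖y‖ < σ₁}` whenever `D₀` is a
vacuum datum (`isVacuumOn_extendByCutoff`: locality of the constraint map under the open inclusion
`U ↪ E3`, Bartnik–Isenberg 2004, §2, via `InitialDataSet.isVacuumAt_comap_iff` and
`InitialDataSet.isVacuumAt_congr`).

## References

* J. Li, H. Mei, *A construction of collapsing spacetimes in vacuum*, Comm. Math. Phys. 378 (2020),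
  arXiv:2005.01249, §2.2 (key `LiMei2020`).
* R. Bartnik, J. Isenberg, *The constraint equations* (2004), §2 (key `BartnikIsenberg2004`).
-/

noncomputable section

open Bundle Set Function Filter Manifold TopologicalSpace
open scoped Manifold ContDiff Topology RealInnerProductSpace

namespace Literature.Geometry.Lorentzian

/-! ### Shortcut instances

Typeclass synthesis on the normed space of bilinear forms `E3 →L[ℝ] E3 →L[ℝ] ℝ` is slow in this
import closure (compare `KerrCylinderParameterCloseness.lean`); these local shortcuts are the
canonical instances. -/

/-- Shortcut: the space of bilinear forms on `E3` is a normed group (canonical instance). -/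
local instance instNormedAddCommGroupBilinE3Ext : NormedAddCommGroup (E3 →L[ℝ] E3 →L[ℝ] ℝ) :=
  ContinuousLinearMap.toNormedAddCommGroup

/-- Shortcut: the space of bilinear forms on `E3` is a normed space (canonical instance). -/
local instance instNormedSpaceBilinE3Ext : NormedSpace ℝ (E3 →L[ℝ] E3 →L[ℝ] ℝ) :=
  ContinuousLinearMap.toNormedSpace

namespace InitialDataSet

variable {U : Opens E3}

/-! ### Coordinate readings of a datum on an open subset of `E3` -/

open scoped Classical in
/-- The metric of a datum on `U ⊆ E3` read as a coefficient map on `E3` (junk `0` off `U`).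
[folklore] -/
def readH (D₀ : InitialDataSet (𝓡 3) U) (y : E3) : E3 →L[ℝ] E3 →L[ℝ] ℝ :=
  if hy : y ∈ U then (show E3 →L[ℝ] E3 →L[ℝ] ℝ from D₀.h.inner ⟨y, hy⟩) else 0

open scoped Classical in
/-- The tensor `k` of a datum on `U ⊆ E3` read as a coefficient map on `E3` (junk `0` off `U`).
[folklore] -/
def readK (D₀ : InitialDataSet (𝓡 3) U) (y : E3) : E3 →L[ℝ] E3 →L[ℝ] ℝ :=
  if hy : y ∈ U then (show E3 →L[ℝ] E3 →L[ℝ] ℝ from D₀.k ⟨y, hy⟩) else 0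

variable (D₀ : InitialDataSet (𝓡 3) U)

/-- On `U`, `readH` is the metric. [folklore] -/
theorem readH_of_mem {y : E3} (hy : y ∈ U) :
    D₀.readH y = (show E3 →L[ℝ] E3 →L[ℝ] ℝ from D₀.h.inner ⟨y, hy⟩) := by
  simp [readH, hy]

/-- On `U`, `readK` is the tensor `k`. [folklore] -/
theorem readK_of_mem {y : E3} (hy : y ∈ U) :
    D₀.readK y = (show E3 →L[ℝ] E3 →L[ℝ] ℝ from D₀.k ⟨y, hy⟩) := by
  simp [readK, hy]

/-- `readH` agrees with the metric along the inclusion `U → E3`. [folklore] -/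
theorem readH_coe (y : U) : D₀.readH y = (show E3 →L[ℝ] E3 →L[ℝ] ℝ from D₀.h.inner y) := by
  rw [readH_of_mem D₀ y.2]

/-- `readK` agrees with `k` along the inclusion `U → E3`. [folklore] -/
theorem readK_coe (y : U) : D₀.readK y = (show E3 →L[ℝ] E3 →L[ℝ] ℝ from D₀.k y) := by
  rw [readK_of_mem D₀ y.2]

/-- **The metric coefficients of a datum on `U` are smooth on `U`** (bundle smoothness of the
section is smoothness of the representative, `OpensChart.contMDiffAt_bilinSection_iff`).
[folklore] -/
theorem contDiffOn_readH : ContDiffOn ℝ ∞ D₀.readH (U : Set E3) := by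
  intro y hy
  have h := (OpensChart.contMDiffAt_bilinSection_iff (⟨y, hy⟩ : U) (fun z : U ↦ D₀.h.inner z)
    D₀.readH (fun z ↦ (D₀.readH_coe z).symm)).1 (D₀.h.contMDiff ⟨y, hy⟩)
  exact h.contDiffWithinAt

/-- **The coefficients of `k` of a datum on `U` are smooth on `U`.** [folklore] -/
theorem contDiffOn_readK : ContDiffOn ℝ ∞ D₀.readK (U : Set E3) := by
  intro y hy
  have h := (OpensChart.contMDiffAt_bilinSection_iff (⟨y, hy⟩ : U) (fun z : U ↦ D₀.k z)
    D₀.readK (fun z ↦ (D₀.readK_coe z).symm)).1 (D₀.contMDiff_k ⟨y, hy⟩)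
  exact h.contDiffWithinAt

/-! ### The cut-off extension -/

variable {σ₁ σ₂ : ℝ}

/-- The metric field of the extension: `φ h₀ + (1 − φ) δ` with `φ = radialCutoff σ₁ σ₂`.
[cite: LiMei2020, §2.2] -/
def extendH (σ₁ σ₂ : ℝ) (y : E3) : E3 →L[ℝ] E3 →L[ℝ] ℝ :=
  radialCutoff σ₁ σ₂ y • D₀.readH y +
    (1 - radialCutoff σ₁ σ₂ y) • (innerSL ℝ (E := E3) : E3 →L[ℝ] E3 →L[ℝ] ℝ)

/-- The tensor field `k` of the extension: `φ k₀`. [cite: LiMei2020, §2.2] -/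
def extendK (σ₁ σ₂ : ℝ) (y : E3) : E3 →L[ℝ] E3 →L[ℝ] ℝ :=
  radialCutoff σ₁ σ₂ y • D₀.readK y

/-- `h̃(y)(v, w) = φ(y) h₀(y)(v, w) + (1 − φ(y)) ⟨v, w⟩`. [folklore] -/
@[simp]
theorem extendH_apply (y v w : E3) :
    D₀.extendH σ₁ σ₂ y v w =
      radialCutoff σ₁ σ₂ y * D₀.readH y v w + (1 - radialCutoff σ₁ σ₂ y) * ⟪v, w⟫ :=
  rfl

/-- `k̃(y)(v, w) = φ(y) k₀(y)(v, w)`. [folklore] -/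
@[simp]
theorem extendK_apply (y v w : E3) :
    D₀.extendK σ₁ σ₂ y v w = radialCutoff σ₁ σ₂ y * D₀.readK y v w :=
  rfl

/-- The extended metric field is symmetric. [folklore] -/
theorem extendH_symm (y v w : E3) : D₀.extendH σ₁ σ₂ y v w = D₀.extendH σ₁ σ₂ y w v := by
  rw [extendH_apply, extendH_apply, real_inner_comm w v]
  by_cases hyU : y ∈ U
  · rw [readH_of_mem D₀ hyU]
    change radialCutoff σ₁ σ₂ y * D₀.h.inner ⟨y, hyU⟩ v w + _ =
      radialCutoff σ₁ σ₂ y * D₀.h.inner ⟨y, hyU⟩ w v + _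
    rw [D₀.h.symm ⟨y, hyU⟩ v w]
  · simp [readH, hyU]

/-- The extended tensor field `k` is symmetric. [folklore] -/
theorem extendK_symm (y v w : E3) : D₀.extendK σ₁ σ₂ y v w = D₀.extendK σ₁ σ₂ y w v := by
  rw [extendK_apply, extendK_apply]
  by_cases hyU : y ∈ U
  · rw [readK_of_mem D₀ hyU]
    change radialCutoff σ₁ σ₂ y * D₀.k ⟨y, hyU⟩ v w = radialCutoff σ₁ σ₂ y * D₀.k ⟨y, hyU⟩ w v
    rw [D₀.k_symm ⟨y, hyU⟩ v w]
  · simp [readK, hyU]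

/-- Off the closed ball `{‖y‖ ≤ σ₂}` the extended metric is Euclidean. [folklore] -/
theorem extendH_of_le_norm (h₁ : 0 ≤ σ₁) (h₁₂ : σ₁ < σ₂) {y : E3} (hy : σ₂ ≤ ‖y‖) :
    D₀.extendH σ₁ σ₂ y = (innerSL ℝ (E := E3) : E3 →L[ℝ] E3 →L[ℝ] ℝ) := by
  ext v w
  rw [extendH_apply, radialCutoff_of_le_norm h₁ h₁₂ hy, zero_mul, zero_add, sub_zero, one_mul]
  rfl

/-- Off the closed ball `{‖y‖ ≤ σ₂}` the extended tensor `k` vanishes. [folklore] -/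
theorem extendK_of_le_norm (h₁ : 0 ≤ σ₁) (h₁₂ : σ₁ < σ₂) {y : E3} (hy : σ₂ ≤ ‖y‖) :
    D₀.extendK σ₁ σ₂ y = 0 := by
  ext v w
  rw [extendK_apply, radialCutoff_of_le_norm h₁ h₁₂ hy, zero_mul]
  rfl

/-- On the closed ball `{‖y‖ ≤ σ₁}` (inside `U`) the extended metric is `h₀`. [folklore] -/
theorem extendH_of_norm_le (h₁ : 0 ≤ σ₁) (h₁₂ : σ₁ < σ₂) {y : E3} (hy : ‖y‖ ≤ σ₁) (hyU : y ∈ U) :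
    D₀.extendH σ₁ σ₂ y = (show E3 →L[ℝ] E3 →L[ℝ] ℝ from D₀.h.inner ⟨y, hyU⟩) := by
  ext v w
  rw [extendH_apply, radialCutoff_of_norm_le h₁ h₁₂ hy, readH_of_mem D₀ hyU]
  ring

/-- On the closed ball `{‖y‖ ≤ σ₁}` (inside `U`) the extended tensor is `k₀`. [folklore] -/
theorem extendK_of_norm_le (h₁ : 0 ≤ σ₁) (h₁₂ : σ₁ < σ₂) {y : E3} (hy : ‖y‖ ≤ σ₁) (hyU : y ∈ U) :
    D₀.extendK σ₁ σ₂ y = (show E3 →L[ℝ] E3 →L[ℝ] ℝ from D₀.k ⟨y, hyU⟩) := by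
  ext v w
  rw [extendK_apply, radialCutoff_of_norm_le h₁ h₁₂ hy, readK_of_mem D₀ hyU, one_mul]

variable (hσ₁ : 0 ≤ σ₁) (hσ₁₂ : σ₁ < σ₂) (hU : ∀ y : E3, ‖y‖ ≤ σ₂ → y ∈ U)
include hσ₁ hσ₁₂ hU

/-- **Smoothness of the extended metric.** On `U` it is a cut-off combination of smooth fields;
near a point off `U` (where `‖y‖ > σ₂`) it is constant `δ`. [folklore] -/
theorem contDiff_extendH : ContDiff ℝ ∞ (D₀.extendH σ₁ σ₂) := by
  rw [contDiff_iff_contDiffAt]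
  intro y
  by_cases hyU : y ∈ U
  · have hs : (U : Set E3) ∈ 𝓝 y := U.isOpen.mem_nhds hyU
    have hH : ContDiffAt ℝ ∞ D₀.readH y := (D₀.contDiffOn_readH y hyU).contDiffAt hs
    exact ((contDiff_radialCutoff σ₁ σ₂).contDiffAt.smul hH).add
      ((contDiffAt_const.sub (contDiff_radialCutoff σ₁ σ₂).contDiffAt).smul contDiffAt_const)
  · have hy : σ₂ < ‖y‖ := lt_of_not_ge fun h ↦ hyU (hU y h)
    have hev : D₀.extendH σ₁ σ₂ =ᶠ[𝓝 y]
        fun _ ↦ (innerSL ℝ (E := E3) : E3 →L[ℝ] E3 →L[ℝ] ℝ) := by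
      filter_upwards [(isOpen_lt continuous_const continuous_norm).mem_nhds hy] with z hz
      exact D₀.extendH_of_le_norm hσ₁ hσ₁₂ hz.le
    exact (contDiffAt_const.congr_of_eventuallyEq hev)

/-- **Smoothness of the extended tensor `k`.** [folklore] -/
theorem contDiff_extendK : ContDiff ℝ ∞ (D₀.extendK σ₁ σ₂) := by
  rw [contDiff_iff_contDiffAt]
  intro y
  by_cases hyU : y ∈ U
  · have hs : (U : Set E3) ∈ 𝓝 y := U.isOpen.mem_nhds hyU
    have hK : ContDiffAt ℝ ∞ D₀.readK y := (D₀.contDiffOn_readK y hyU).contDiffAt hs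
    exact (contDiff_radialCutoff σ₁ σ₂).contDiffAt.smul hK
  · have hy : σ₂ < ‖y‖ := lt_of_not_ge fun h ↦ hyU (hU y h)
    have hev : D₀.extendK σ₁ σ₂ =ᶠ[𝓝 y] fun _ ↦ (0 : E3 →L[ℝ] E3 →L[ℝ] ℝ) := by
      filter_upwards [(isOpen_lt continuous_const continuous_norm).mem_nhds hy] with z hz
      exact D₀.extendK_of_le_norm hσ₁ hσ₁₂ hz.le
    exact (contDiffAt_const.congr_of_eventuallyEq hev)

/-- **The extended metric is Riemannian** (a convex combination of `h₀` and `δ` on `U`, `δ` off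
`U`). [folklore] -/
theorem extendH_pos (y : E3) {v : E3} (hv : v ≠ 0) : 0 < D₀.extendH σ₁ σ₂ y v v := by
  rw [extendH_apply]
  have h0 := radialCutoff_nonneg σ₁ σ₂ y
  have h1 := radialCutoff_le_one σ₁ σ₂ y
  have hδ : 0 < ⟪v, v⟫ := real_inner_self_pos.2 hv
  by_cases hyU : y ∈ U
  · rw [readH_of_mem D₀ hyU]
    have ha : 0 < D₀.h.inner ⟨y, hyU⟩ v v := D₀.h.pos ⟨y, hyU⟩ v hv
    change 0 < radialCutoff σ₁ σ₂ y * D₀.h.inner ⟨y, hyU⟩ v v + (1 - radialCutoff σ₁ σ₂ y) * ⟪v, v⟫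
    rcases h0.eq_or_lt with h | h
    · rw [← h]; simpa using hδ
    · nlinarith [mul_pos h ha, mul_nonneg (sub_nonneg.2 h1) hδ.le]
  · have hy : σ₂ < ‖y‖ := lt_of_not_ge fun h ↦ hyU (hU y h)
    rw [radialCutoff_of_le_norm hσ₁ hσ₁₂ hy.le]
    simpa using hδ

/-- **The cut-off extension of a datum from a ball to `E3`**: for a datum `D₀` on an open
`U ⊇ {‖y‖ ≤ σ₂}` and `0 ≤ σ₁ < σ₂`, the smooth initial data set
`(φ h₀ + (1 − φ) δ, φ k₀)` on `E3`, `φ = radialCutoff σ₁ σ₂` — equal to `D₀` on `{‖y‖ ≤ σ₁}`,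
flat `(δ, 0)` off `{‖y‖ < σ₂}`. This is the "arbitrary smooth extension beyond the ball" of the
transported statements of Li–Mei arXiv:2005.01249, §2.2 (`LiMei.shortPulseCylinderData`).
[cite: LiMei2020, §2.2] -/
def extendByCutoff : InitialDataSet (𝓡 3) E3 where
  h :=
    { inner := fun y ↦ D₀.extendH σ₁ σ₂ y
      symm := fun y v w ↦ D₀.extendH_symm y v w
      pos := fun y _ hv ↦ D₀.extendH_pos hσ₁ hσ₁₂ hU y hv
      isVonNBounded := fun y ↦
        PseudoRiemannianMetric.IsSpacelikeImmersion.isVonNBounded_setOf_lt_one_of_pos (V := E3)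
          (D₀.extendH σ₁ σ₂ y) (fun _ hv ↦ D₀.extendH_pos hσ₁ hσ₁₂ hU y hv)
      contMDiff := fun _ ↦ (contMDiffAt_bilinE3_iff (b := fun y : E3 ↦ y)
        (s := D₀.extendH σ₁ σ₂)).2
        ⟨contMDiffAt_id, (D₀.contDiff_extendH hσ₁ hσ₁₂ hU).contDiffAt.contMDiffAt⟩ }
  k := fun y ↦ D₀.extendK σ₁ σ₂ y
  k_symm := fun y v w ↦ D₀.extendK_symm y v w
  contMDiff_k := fun _ ↦ (contMDiffAt_bilinE3_iff (b := fun y : E3 ↦ y)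
    (s := D₀.extendK σ₁ σ₂)).2
    ⟨contMDiffAt_id, (D₀.contDiff_extendK hσ₁ hσ₁₂ hU).contDiffAt.contMDiffAt⟩

/-- The metric of the extension is `extendH`. [folklore] -/
@[simp]
theorem extendByCutoff_h_inner (y : E3) :
    (D₀.extendByCutoff hσ₁ hσ₁₂ hU).h.inner y = D₀.extendH σ₁ σ₂ y := rfl

/-- The tensor `k` of the extension is `extendK`. [folklore] -/
@[simp]
theorem extendByCutoff_k (y : E3) : (D₀.extendByCutoff hσ₁ hσ₁₂ hU).k y = D₀.extendK σ₁ σ₂ y := rfl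

/-- **On `{‖y‖ ≤ σ₁}` the extension has the metric of `D₀`.** [cite: LiMei2020, §2.2] -/
theorem extendByCutoff_h_inner_of_norm_le {y : E3} (hy : ‖y‖ ≤ σ₁) :
    (D₀.extendByCutoff hσ₁ hσ₁₂ hU).h.inner y =
      (show E3 →L[ℝ] E3 →L[ℝ] ℝ from D₀.h.inner ⟨y, hU y (hy.trans hσ₁₂.le)⟩) := by
  rw [extendByCutoff_h_inner]
  exact D₀.extendH_of_norm_le hσ₁ hσ₁₂ hy _

/-- **On `{‖y‖ ≤ σ₁}` the extension has the tensor `k` of `D₀`.** [cite: LiMei2020, §2.2] -/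
theorem extendByCutoff_k_of_norm_le {y : E3} (hy : ‖y‖ ≤ σ₁) :
    (D₀.extendByCutoff hσ₁ hσ₁₂ hU).k y =
      (show E3 →L[ℝ] E3 →L[ℝ] ℝ from D₀.k ⟨y, hU y (hy.trans hσ₁₂.le)⟩) := by
  rw [extendByCutoff_k]
  exact D₀.extendK_of_norm_le hσ₁ hσ₁₂ hy _

/-- **The extension of a vacuum datum satisfies the vacuum constraints on the ball `{‖y‖ < σ₁}`.**
Read the extension `D` back on `U` through the open inclusion `ι : U → E3`: `ι^* D` and `D₀` have
the same sections near every point of `{‖y‖ < σ₁}`, so they satisfy the constraints there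
simultaneously (`isVacuumAt_congr`), and `ι^* D` does iff `D` does (`isVacuumAt_comap_iff`: the
constraint map is natural under local diffeomorphisms). Bartnik–Isenberg 2004, §2 (local character
of the constraints). [cite: BartnikIsenberg2004, §2] -/
theorem isVacuumOn_extendByCutoff
    (hvac : ∀ [D₀.metric.HasLeviCivita], D₀.IsVacuumConstraintSolution) :
    LiMei.IsVacuumOn {y : E3 | ‖y‖ < σ₁} (D₀.extendByCutoff hσ₁ hσ₁₂ hU) := by
  intro inst y hy
  set D := D₀.extendByCutoff hσ₁ hσ₁₂ hU with hD
  have hyU : y ∈ U := hU y (hy.le.trans hσ₁₂.le)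
  -- the pull-back of `D` to `U` along the inclusion
  set D' : InitialDataSet (𝓡 3) U := D.comap (Subtype.val : U → E3) (contMDiff_subtypeVal_succ U)
    (injective_mfderiv_subtypeVal U) with hD'
  haveI hD'LC : D'.metric.HasLeviCivita := PseudoRiemannianMetric.hasLeviCivita _
  haveI hD₀LC : D₀.metric.HasLeviCivita := PseudoRiemannianMetric.hasLeviCivita _
  -- `D` is vacuum at `y` iff `D'` is vacuum at `⟨y, hyU⟩`
  rw [← D.isVacuumAt_comap_iff (contMDiff_subtypeVal_succ U) (injective_mfderiv_subtypeVal U)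
    (⟨y, hyU⟩ : U)]
  -- `D'` and `D₀` agree near `⟨y, hyU⟩`
  have hball : ∀ᶠ z : U in 𝓝 (⟨y, hyU⟩ : U), ‖(z : E3)‖ < σ₁ :=
    (isOpen_lt continuous_norm continuous_const).preimage continuous_subtype_val |>.mem_nhds hy
  have hh : ∀ᶠ z : U in 𝓝 (⟨y, hyU⟩ : U), D'.h.inner z = D₀.h.inner z := by
    filter_upwards [hball] with z hz
    ext v w
    rw [hD', comap_h_inner, Literature.Geometry.Manifold.OpenSubmanifold.mfderiv_subtype_val]
    change D.h.inner (z : E3) v w = D₀.h.inner z v w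
    rw [hD, D₀.extendByCutoff_h_inner_of_norm_le hσ₁ hσ₁₂ hU hz.le]
    rfl
  have hk : ∀ᶠ z : U in 𝓝 (⟨y, hyU⟩ : U), D'.k z = D₀.k z := by
    filter_upwards [hball] with z hz
    ext v w
    rw [hD', comap_k, Literature.Geometry.Manifold.OpenSubmanifold.mfderiv_subtype_val]
    change D.k (z : E3) v w = D₀.k z v w
    rw [hD, D₀.extendByCutoff_k_of_norm_le hσ₁ hσ₁₂ hU hz.le]
    rfl
  rw [isVacuumAt_congr hh hk]
  exact hvac ⟨y, hyU⟩

end InitialDataSet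

end Literature.Geometry.Lorentzian

end
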